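import Summits.MatrixMultiplication.MatrixMultiplication.Theorems.OutsiderSandwichPackingSlack
import Summits.MatrixMultiplication.MatrixMultiplication.Theorems.OutsiderSandwichPencilLaw

/-!
# Outsider sandwich — the PENCIL SLACK LAW for packings of `⟨m,m,m⟩` into `cw₂^{⊠N}` (K38-2e)

decomp-mm lens-4, generation 38, Part IIe (helper toward `LaserTangency`, stmt-32268; theses-free,
definition-free).  The slack law of Part I (`OutsiderSandwichPackingSlack.slack_law`) transports the
SINGLE-slice floor `rank T_N(η) ≥ 2^N` of `cw₂^{⊠N}` through a restriction
`cw₂^{⊠N} ≥ B·⟨m,m,m⟩` and reads `2^N + 2·B·m² ≤ m + 2·3^N`.  Here the floor is replaced by the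
PENCIL LAW of Part IId (`OutsiderSandwichPencilLaw.pencil_law`): every `≥ 3`-dimensional space of
covectors of the diagonalised Coppersmith–Winograd tensor `D^{⊠N}` contains a slice of rank
`≥ (3/2)·2^N`.  Transporting a cheap `3`-space on the matrix-multiplication side (covectors supported
on one row of one copy: all slices of rank `≤ m`) gives

* `restrictsTo_cwTwo` — the explicit isomorphism `D ≥ cw₂` over `ℂ` (`x₁² + x₂² = (x₁+ix₂)(x₁−ix₂)`),
  `D a b c = [a, b, c pairwise distinct]`;
* `floor3_le_of_restricts` — the 3-space transport: a floor valid on every `3`-space of covectors of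
  `t` and a `3`-space of covectors of a concise `s` with slices of rank `≤ ρ` give, under `t ≥ s`,
  `r + 2(|κ'| + |μ'|) ≤ 2ρ + 2(|κ| + |μ|)`;
* `rank_sliceMat_pack_row_le` — covectors of `F·⟨m,m,m⟩` supported on `{(f₀, (i₀, ν))}_ν` have
  slices of rank `≤ m`;
* `pencil_slack_law` — `3 ≤ m`, `cw₂^{⊠N} ≥ F·⟨m,m,m⟩ ⟹ 3·2^N + 4·F·m² ≤ 2m + 4·3^N`
  (deficit `3^N − F m² ≥ (3·2^N − 2m)/4`, i.e. `3/2` times the Part-I deficit);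
* cells decided beyond Part I: `8·⟨3,3,3⟩ ≰ cw₂^{⊠4}` (Part I: `9`), `25·⟨3,3,3⟩ ≰ cw₂^{⊠5}`
  (Part I: `26`; this DECIDES the first undecided census cell `(5,3,25)` of NODE-g37/g38 negatively
  and proves the g37 handoff conjecture `9B ≤ 3^N − 3^{N−2}` at `N = 5`), `76·⟨3,3,3⟩ ≰ cw₂^{⊠6}`
  (Part I: `78`), `43·⟨4,4,4⟩ ≰ cw₂^{⊠6}` (Part I: `44`).

Honest tag: WEAKER·INSTRUMENT — the floor still lives at scale `2^N` (now `1.5·2^N`), so it does not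
touch the exponential rates in `LaserTangency` / `LaserMergeOptimal`; it sharpens the quantitative
census of small cells and records the pencil calculus of `cw₂^{⊠N}`.

References.
* D. Coppersmith, S. Winograd, *Matrix multiplication via arithmetic progressions*,
  J. Symbolic Comput. 9 (1990) 251–280, §6. [CoppersmithWinograd1990]
* M. Bläser, C. Ikenmeyer, V. Lysikov, A. Pandey, F.-O. Schreyer, *Variety membership testing,
  algebraic natural proofs, and geometric complexity theory*, arXiv:1911.02534, Def. 13 (minrank).
  [BlaserIkenmeyerLysikovPandeySchreyer2019]
* J. M. Landsberg, *Geometry and Complexity Theory*, CUP 2017, §3.4.9 (the tensor `T_{q,cw}`;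
  it is symmetric, with cubic form `3·x₀(x₁² + ⋯ + x_q²)`). [LandsbergGCT2017]
* R. A. Horn, C. R. Johnson, *Matrix Analysis*, 2nd ed., CUP 2013, §0.4.5. [HornJohnson2013]
-/

set_option linter.dupNamespace false

namespace Summit.MatrixMultiplication.MatrixMultiplication.Theorems.OutsiderSandwichPencilSlack

open Literature.Computability.AlgebraicComplexity
open OutsiderSandwichNoExactPerfection OutsiderSandwichNoExactPerfectPacking
open OutsiderSandwichPackingSlack OutsiderSandwichPencilLaw
open scoped Matrix

/-! ## 1. The diagonalised Coppersmith–Winograd tensor restricts to `cw₂` -/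

/-- Over `ℂ`, `cw₂ = (M, M, M)·D` with `M = [[1/2,0,0],[0,1,1],[0,i,−i]]`, where
`D a b c = [a,b,c pairwise distinct]`: as cubic forms `3x₀(x₁²+x₂²) = 6·(x₀/2)(x₁+ix₂)(x₁−ix₂)`
(checked entrywise). [cite: LandsbergGCT2017, §3.4.9; folklore] -/
theorem restrictsTo_cwTwo {D : Fin 3 → Fin 3 → Fin 3 → ℂ}
    (hD : ∀ a b c, D a b c = if a ≠ b ∧ b ≠ c ∧ a ≠ c then 1 else 0) :
    TensorRestrictsTo D (cwTensor ℂ 2) := by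
  refine ⟨!![(1/2 : ℂ), 0, 0; 0, 1, 1; 0, Complex.I, -Complex.I],
    !![(1/2 : ℂ), 0, 0; 0, 1, 1; 0, Complex.I, -Complex.I],
    !![(1/2 : ℂ), 0, 0; 0, 1, 1; 0, Complex.I, -Complex.I], fun a' b' c' => ?_⟩
  rw [cwTensor_apply]
  simp only [Fin.sum_univ_three, hD]
  fin_cases a' <;> fin_cases b' <;> fin_cases c' <;> simp <;> ring_nf <;> simp [Complex.I_sq]

/-! ## 2. The 3-space transport -/

section General

variable {K : Type*} [Field K]
variable {ι κ μ ι' κ' μ' : Type*} [Fintype ι] [Fintype κ] [Fintype μ]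
  [Fintype ι'] [Fintype κ'] [Fintype μ']
  [DecidableEq ι] [DecidableEq κ] [DecidableEq μ] [DecidableEq ι'] [DecidableEq κ'] [DecidableEq μ']

/-- **3-space transport.**  If every `3`-space of covectors of `t` contains a slice of doubled rank
`≥ r`, `s` is concise, and `U` is a `≥ 3`-dimensional space of covectors of `s` all of whose slices
have rank `≤ ρ`, then `t ≥ s` forces `r + 2(|κ'| + |μ'|) ≤ 2ρ + 2(|κ| + |μ|)`: pull `U` back along
the (injective) first restriction map and sandwich with slack (Part I). [folklore; Sylvester] -/
theorem floor3_le_of_restricts {t : ι → κ → μ → K} {s : ι' → κ' → μ' → K} {r ρ : ℕ}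
    (hfloor : ∀ W : Submodule K (ι → K), 3 ≤ Module.finrank K ↥W →
      ∃ η ∈ W, r ≤ 2 * (sliceMat t η).rank)
    (h1 : LinearIndependent K (fun a' => s a' : ι' → κ' → μ' → K))
    (h2 : LinearIndependent K (fun b' => rotate s b' : κ' → μ' → ι' → K))
    (h3 : LinearIndependent K (fun c' => rotate (rotate s) c' : μ' → ι' → κ' → K))
    (U : Submodule K (ι' → K)) (hU : 3 ≤ Module.finrank K ↥U)
    (hρ : ∀ ξ ∈ U, (sliceMat s ξ).rank ≤ ρ) (h : TensorRestrictsTo t s) :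
    r + 2 * (Fintype.card κ' + Fintype.card μ') ≤ 2 * ρ + 2 * (Fintype.card κ + Fintype.card μ) := by
  obtain ⟨A, B, C, hs⟩ := h
  have hA := toLin'_injective_of_restricts hs h1
  have hB := toLin'_injective_of_restricts (restricts_rotate hs) h2
  have hC := toLin'_injective_of_restricts (restricts_rotate (restricts_rotate hs)) h3
  have hW : 3 ≤ Module.finrank K ↥(U.map (Matrix.toLin' (Matrix.of A)ᵀ)) := by
    rw [← LinearEquiv.finrank_eq (Submodule.equivMapOfInjective _ hA U)]
    exact hU
  obtain ⟨η, hηW, hr⟩ := hfloor _ hW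
  obtain ⟨ξ, hξU, hξη⟩ := Submodule.mem_map.mp hηW
  have hη : ξ ᵥ* Matrix.of A = η := by
    rw [← hξη, Matrix.toLin'_apply, Matrix.mulVec_transpose]
  have hS : sliceMat s ξ = Matrix.of B * sliceMat t η * (Matrix.of C)ᵀ := by
    rw [sliceMat_restricts hs ξ, hη]
  have hsand := rank_le_rank_sandwich_add hB hC (sliceMat t η)
  rw [← hS] at hsand
  have hρ' := hρ ξ hξU
  omega

end General

/-! ## 3. A cheap pencil on the matrix-multiplication side -/

/-- A covector of `F·⟨m,m,m⟩` supported on the forms `Z_{i₀ ν}` of one copy `f₀` has slice of rank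
`≤ m`: all its nonzero rows are indexed by the variables `X_{i₀ μ}` of that copy. [folklore] -/
theorem rank_sliceMat_pack_row_le (F m : ℕ) (f₀ : Fin F) (i₀ : Fin m)
    (ξ : Fin F × (Fin m × Fin m) → ℂ) (hξ : ∀ a, ξ a ≠ 0 → a.1 = f₀ ∧ a.2.1 = i₀) :
    (sliceMat (kroneckerTensor (unitTensor ℂ F) (matMulTensor ℂ m m m)) ξ).rank ≤ m := by
  classical
  set M := sliceMat (kroneckerTensor (unitTensor ℂ F) (matMulTensor ℂ m m m)) ξ with hM
  have hrow : ∀ b c, ¬ (b.1 = f₀ ∧ b.2.1 = i₀) → M b c = 0 := by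
    intro b c hb
    rw [hM, sliceMat_eq_contract3, contract3_apply]
    refine Finset.sum_eq_zero fun a _ => ?_
    by_cases ha : ξ a = 0
    · rw [ha, zero_mul]
    · obtain ⟨h1, h2⟩ := hξ a ha
      simp only [kroneckerTensor_apply, unitTensor_apply, matMulTensor]
      by_cases hP : a.1 = b.1 ∧ b.1 = c.1
      · by_cases hQ : a.2.1 = b.2.1 ∧ b.2.2 = c.2.1 ∧ a.2.2 = c.2.2
        · exact absurd ⟨hP.1.symm.trans h1, hQ.1.symm.trans h2⟩ hb
        · rw [if_neg hQ, mul_zero, mul_zero]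
      · rw [if_neg hP, zero_mul, mul_zero]
  let g : Fin m → Fin F × (Fin m × Fin m) := fun ν => (f₀, (i₀, ν))
  let P : Matrix (Fin F × (Fin m × Fin m)) (Fin m) ℂ := fun b ν => if b = g ν then 1 else 0
  have hfac : M = P * M.submatrix g id := by
    ext b c
    rw [Matrix.mul_apply]
    by_cases hb : b.1 = f₀ ∧ b.2.1 = i₀
    · have hbg : b = g b.2.2 := by
        obtain ⟨f, i, ν⟩ := b
        simp only at hb
        obtain ⟨rfl, rfl⟩ := hb
        rfl
      rw [Finset.sum_eq_single b.2.2]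
      · simp [P, ← hbg]
      · intro ν _ hν
        have hne : b ≠ g ν := by
          intro h
          apply hν
          have := congr_arg (fun x : Fin F × (Fin m × Fin m) => x.2.2) h
          simpa [g] using this.symm
        simp [P, hne]
      · simp
    · rw [hrow b c hb]
      refine (Finset.sum_eq_zero fun ν _ => ?_).symm
      have hne : b ≠ g ν := by
        rintro rfl
        exact hb ⟨rfl, rfl⟩
      simp [P, hne]
  rw [hfac]
  calc (P * M.submatrix g id).rank ≤ P.rank := Matrix.rank_mul_le_left _ _
    _ ≤ Fintype.card (Fin m) := Matrix.rank_le_card_width _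
    _ = m := Fintype.card_fin m

/-! ## 4. The pencil slack law -/

/-- **Pencil slack law.**  `3 ≤ m`, `0 < F`, `cw₂^{⊠N} ≥ F·⟨m,m,m⟩ ⟹ 3·2^N + 4·F·m² ≤ 2m + 4·3^N`:
the pencil law of `D^{⊠N} ≅ cw₂^{⊠N}` (doubled floor `3·2^N` on every `3`-space) transported along
the `m`-space of covectors `Z_{0ν}` of copy `0` (all slices of rank `≤ m`).
[cite: CoppersmithWinograd1990, §6; BlaserIkenmeyerLysikovPandeySchreyer2019, Def. 13] -/
theorem pencil_slack_law {N F m : ℕ} (hF : 0 < F) (hm : 3 ≤ m)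
    (h : TensorRestrictsTo (kroneckerPow (cwTensor ℂ 2) N)
      (kroneckerTensor (unitTensor ℂ F) (matMulTensor ℂ m m m))) :
    3 * 2 ^ N + 4 * (F * m ^ 2) ≤ 2 * m + 4 * 3 ^ N := by
  classical
  haveI : NeZero m := ⟨by omega⟩
  let D : Fin 3 → Fin 3 → Fin 3 → ℂ := fun a b c => if a ≠ b ∧ b ≠ c ∧ a ≠ c then 1 else 0
  have hD : ∀ a b c, D a b c = if a ≠ b ∧ b ≠ c ∧ a ≠ c then 1 else 0 := fun _ _ _ => rfl
  have hres : TensorRestrictsTo (kroneckerPow D N)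
      (kroneckerTensor (unitTensor ℂ F) (matMulTensor ℂ m m m)) :=
    ((restrictsTo_cwTwo hD).kroneckerPow N).trans h
  have hfloor : ∀ W : Submodule ℂ ((Fin N → Fin 3) → ℂ), 3 ≤ Module.finrank ℂ ↥W →
      ∃ η ∈ W, 3 * 2 ^ N ≤ 2 * (sliceMat (kroneckerPow D N) η).rank :=
    fun W hW => pencil_law hD N W hW
  let f₀ : Fin F := ⟨0, hF⟩
  let i₀ : Fin m := ⟨0, by omega⟩
  let Lc : (Fin m → ℂ) →ₗ[ℂ] (Fin F × (Fin m × Fin m) → ℂ) :=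
    { toFun := fun c a => if a.1 = f₀ ∧ a.2.1 = i₀ then c a.2.2 else 0
      map_add' := fun x y => by
        funext a
        by_cases ha : a.1 = f₀ ∧ a.2.1 = i₀ <;> simp [ha]
      map_smul' := fun s x => by
        funext a
        by_cases ha : a.1 = f₀ ∧ a.2.1 = i₀ <;> simp [ha] }
  have hLc : ∀ c a, Lc c a = if a.1 = f₀ ∧ a.2.1 = i₀ then c a.2.2 else 0 := fun _ _ => rfl
  have hinj : Function.Injective Lc := by
    intro x y hxy
    funext ν
    have := congr_fun hxy (f₀, (i₀, ν))
    simpa [hLc] using this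
  have hU : 3 ≤ Module.finrank ℂ ↥(LinearMap.range Lc) := by
    rw [LinearMap.finrank_range_of_inj hinj, Module.finrank_fintype_fun_eq_card, Fintype.card_fin]
    exact hm
  have hρ : ∀ ξ ∈ LinearMap.range Lc,
      (sliceMat (kroneckerTensor (unitTensor ℂ F) (matMulTensor ℂ m m m)) ξ).rank ≤ m := by
    rintro _ ⟨c, rfl⟩
    refine rank_sliceMat_pack_row_le F m f₀ i₀ _ fun a ha => ?_
    by_contra hcon
    exact ha (by rw [hLc, if_neg hcon])
  have key := floor3_le_of_restricts hfloor (linearIndependent_pack F m)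
    (linearIndependent_rotate_pack F m) (linearIndependent_rotate_rotate_pack F m) _ hU hρ hres
  simp only [Fintype.card_prod, Fintype.card_fin, Fintype.card_fun] at key
  rw [sq]
  generalize F * (m * m) = V at key ⊢
  omega

/-- In deficit form: `cw₂^{⊠N} ≥ F·⟨m,m,m⟩` with `m ≥ 3` forces `4·(3^N − F·m²) ≥ 3·2^N − 2m`
(truncated subtraction; the volume bound `F·m² ≤ 3^N` is gen-6/Part I and not re-proved here). -/
theorem three_two_pow_le_deficit {N F m : ℕ} (hF : 0 < F) (hm : 3 ≤ m)
    (h : TensorRestrictsTo (kroneckerPow (cwTensor ℂ 2) N)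
      (kroneckerTensor (unitTensor ℂ F) (matMulTensor ℂ m m m))) :
    3 * 2 ^ N ≤ 2 * m + 4 * (3 ^ N - F * m ^ 2) := by
  have := pencil_slack_law hF hm h
  omega

/-! ## 5. Census cells decided beyond Part I -/

/-- `8·⟨3,3,3⟩ ≰ cw₂^{⊠4}` (Part I excluded `9`; volume allows `9`). -/
theorem not_pack_eight_three_le_cwPow_four :
    ¬ TensorRestrictsTo (kroneckerPow (cwTensor ℂ 2) 4)
      (kroneckerTensor (unitTensor ℂ 8) (matMulTensor ℂ 3 3 3)) := by
  intro h
  have := pencil_slack_law (by norm_num) le_rfl h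
  norm_num at this

/-- `25·⟨3,3,3⟩ ≰ cw₂^{⊠5}` — the first undecided census cell `(N,m,B) = (5,3,25)` of NODE-g37/g38
is decided negatively (Part I excluded `26`, volume allows `27`); equivalently `9B ≤ 3^5 − 3^3`. -/
theorem not_pack_twentyfive_three_le_cwPow_five :
    ¬ TensorRestrictsTo (kroneckerPow (cwTensor ℂ 2) 5)
      (kroneckerTensor (unitTensor ℂ 25) (matMulTensor ℂ 3 3 3)) := by
  intro h
  have := pencil_slack_law (by norm_num) le_rfl h
  norm_num at this

/-- `76·⟨3,3,3⟩ ≰ cw₂^{⊠6}` (Part I excluded `78`, volume allows `81`). -/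
theorem not_pack_seventysix_three_le_cwPow_six :
    ¬ TensorRestrictsTo (kroneckerPow (cwTensor ℂ 2) 6)
      (kroneckerTensor (unitTensor ℂ 76) (matMulTensor ℂ 3 3 3)) := by
  intro h
  have := pencil_slack_law (by norm_num) le_rfl h
  norm_num at this

/-- `43·⟨4,4,4⟩ ≰ cw₂^{⊠6}` (Part I excluded `44`, volume allows `45`). -/
theorem not_pack_fortythree_four_le_cwPow_six :
    ¬ TensorRestrictsTo (kroneckerPow (cwTensor ℂ 2) 6)
      (kroneckerTensor (unitTensor ℂ 43) (matMulTensor ℂ 4 4 4)) := by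
  intro h
  have := pencil_slack_law (by norm_num) (by norm_num) h
  norm_num at this

/-- `B` copies of `⟨3,3,3⟩` inside `cw₂^{⊠N}` obey `9B ≤ 3^N − (3·2^N − 6)/4`; in particular the
NODE-g37 handoff inequality `9B ≤ 3^N − 3^{N−2}` holds for all `N ≤ 5`. [this file] -/
theorem nine_mul_le_of_pack_three {N B : ℕ} (hB : 0 < B)
    (h : TensorRestrictsTo (kroneckerPow (cwTensor ℂ 2) N)
      (kroneckerTensor (unitTensor ℂ B) (matMulTensor ℂ 3 3 3))) :
    3 * 2 ^ N + 36 * B ≤ 6 + 4 * 3 ^ N := by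
  have := pencil_slack_law hB le_rfl h
  norm_num at this
  omega

end Summit.MatrixMultiplication.MatrixMultiplication.Theorems.OutsiderSandwichPencilSlack
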